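import Summits.PneNP.PneNP.Theorems.SymmetryBudgetNoHiddenOrderPerPathCanonRealise
import Summits.PneNP.PneNP.Theorems.SymmetryBudgetNoHiddenOrderCertifiedScheme

/-!
# The components-only Corneil–Goldberg process as a certified-label `Process` with a realised `Valuation`

Route `PneNP/SymmetryBudget`, `NoHiddenOrder` (stmt-PneNP-14781). Glue between the function-level per-path canoniser
(`…PerPathCanon*.lean`, PER-PATH.md §12) and the abstract certified-label scheme of `…CertifiedSchemeDefs.lean`
(ANALYSIS-4 §2: `CertifiedLabels.Process`, `CertifiedLabels.Valuation`, whose soundness `val_sound` and completeness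
`val_complete_replay` are kernel-checked for ANY instance):

* `cgProcess G : CertifiedLabels.Process V` — instances are non-empty blocks with a colouring `(A, col)`; the step at
  `(A, col)` is the step of `canon`: a SECTION node with parts the switching components `(swReach G A col u, col)` when the
  switching graph is disconnected inside `A`, else an INDIVIDUALISATION node with cell `smallestCell A col` and children
  `(A, refineIn G A (indiv col x))` when `|A| ≥ 2` and that cell has `≥ 2` vertices, else a LEAF (`|A| ≤ 1`, or the
  degenerate case that equitable colourings never reach);
* `cgValuation G : CertifiedLabels.Valuation (cgProcess G) Enc` — values are encodings, `Good (A, col) E` means "`E` is the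
  copy of `(A, col)` read along an enumeration of `A`" (`encOf`), leaves are read along `A.toList`, PASTING is `assembleAND`
  of the sorted part values with the colour-level switching data (P1 = `exists_assembleAND_sort_eq_encOf`, from
  `assembleAND_map_encOf`), LIFTING is the colour read-back `recolour (colMap …)` (P2 = `colMap_refineIn_indiv`), and the
  choice is the lexicographic minimum.
Also the structural facts the completeness theorem consumes: parts are proper, non-empty, pairwise disjoint
(`cgStep_parts_disjoint`), children keep the vertex set (`verts_cgChild`).

Main definitions: `CGInst`, `cgParts`, `cgChild`, `cgStep`, `cgProcess`, `CGGood`, `cgPaste`, `cgLift`, `cgPick`, `cgValuation`;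
`cg_val_sound` instantiates the scheme's soundness.
-/

-- `Summit.PneNP.PneNP.…` duplicates `PneNP` BY DESIGN (single-problem summit, D-0017 layout).
set_option linter.dupNamespace false

namespace Summit.PneNP.PneNP.Theorems

open Finset

namespace BranchSum

variable {V : Type*} [DecidableEq V] (G : SimpleGraph V) [DecidableRel G.Adj]

/-! ### Two read-back facts of the realisation, as standalone lemmas -/

variable {G} in
/-- After an OR-step the colour read-back `colMap` recovers `col` on `A`. -/
theorem colMap_refineIn_indiv {A : Finset V} (col : V → ℕ) (x : V) {u : V} (hu : u ∈ A) :
    colMap A (refineIn G A (indiv col x)) col (refineIn G A (indiv col x) u) = col u := by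
  unfold colMap
  apply le_antisymm
  · refine Finset.sup_le fun k hk => ?_
    obtain ⟨w, hw, rfl⟩ := mem_image.1 hk
    rw [mem_filter] at hw
    exact (indiv_refines _ _ (refineIn_refines (G := G) _ hw.1 hu hw.2)).le
  · exact le_sup (f := id) (mem_image_of_mem col (mem_filter.2 ⟨hu, rfl⟩))

variable {G} in
/-- **(P1) for the concrete process.** Sorting and gluing realised copies of the switching components of `(A, col)` — each
component enumerated exactly once — realises `(A, col)`. -/
theorem exists_assembleAND_sort_eq_encOf {A : Finset V} {col : V → ℕ} (Ls : List (List V)) (hnd : ∀ l ∈ Ls, l.Nodup)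
    (hparts : List.Perm (Ls.map List.toFinset) (A.image fun u => swReach G A col u).toList) (Es : List Enc)
    (hEs : List.Perm Es (Ls.map (encOf G col))) :
    ∃ l : List V, l.Nodup ∧ l.toFinset = A ∧
      assembleAND (fun k k' => decide (SwCompC G A col k k')) (Es.insertionSort (· ≤ ·)) = encOf G col l := by
  -- the sorted list is `L.map encOf` for a permutation `L` of `Ls`
  obtain ⟨L, hL, hLperm⟩ : Relation.Comp (· = List.map (encOf G col) ·) List.Perm (Es.insertionSort (· ≤ ·)) Ls := by
    rw [List.eq_map_comp_perm]
    exact (List.perm_insertionSort _ _).trans hEs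
  have hLfin : List.Perm (L.map List.toFinset) (A.image fun u => swReach G A col u).toList :=
    (hLperm.map List.toFinset).trans hparts
  have hmemK : ∀ l ∈ L, ∃ u ∈ A, swReach G A col u = l.toFinset := fun l hl => by
    have : l.toFinset ∈ (A.image fun u => swReach G A col u).toList := hLfin.subset (List.mem_map.2 ⟨l, hl, rfl⟩)
    exact mem_image.1 (mem_toList.1 this)
  -- two members with different vertex sets are different components: disjoint, uniform cross data
  have hdist : ∀ l₁ ∈ L, ∀ l₂ ∈ L, l₁.toFinset ≠ l₂.toFinset → ∀ u ∈ l₁, ∀ w ∈ l₂,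
      u ≠ w ∧ ¬ (swGraph G A col).Adj u w := by
    intro l₁ hl₁ l₂ hl₂ hne u hu w hw
    obtain ⟨a, ha, hKa⟩ := hmemK l₁ hl₁
    obtain ⟨b, hb, hKb⟩ := hmemK l₂ hl₂
    have hu' : u ∈ swReach G A col a := hKa ▸ List.mem_toFinset.2 hu
    have hw' : w ∈ swReach G A col b := hKb ▸ List.mem_toFinset.2 hw
    have hKu : swReach G A col u = swReach G A col a := swReach_eq_of_mem col ha hu'
    have hKw : swReach G A col w = swReach G A col b := swReach_eq_of_mem col hb hw'
    refine ⟨?_, fun hadj => ?_⟩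
    · rintro rfl; exact hne (hKa.symm.trans ((hKu.symm.trans hKw).trans hKb))
    · have hw'' : w ∈ swReach G A col a := swReach_closed col a hu' (swReach_subset A col b hw') hadj
      exact hne (hKa.symm.trans (((swReach_eq_of_mem col ha hw'').symm.trans hKw).trans hKb))
  have hadj_iff : ∀ l₁ ∈ L, ∀ l₂ ∈ L, l₁.toFinset ≠ l₂.toFinset → ∀ u ∈ l₁, ∀ w ∈ l₂,
      (G.Adj u w ↔ SwComp G A col u w) := by
    intro l₁ hl₁ l₂ hl₂ hne u hu w hw
    obtain ⟨hne', hnadj⟩ := hdist l₁ hl₁ l₂ hl₂ hne u hu w hw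
    rw [swGraph_adj] at hnadj
    by_contra h
    exact hnadj ⟨hne', by tauto⟩
  have hpne : L.Pairwise fun l₁ l₂ => l₁.toFinset ≠ l₂.toFinset :=
    List.pairwise_map.1 (hLfin.nodup_iff.2 (nodup_toList _))
  have hpw : L.Pairwise fun l₁ l₂ =>
      (∀ u ∈ l₁, ∀ w ∈ l₂, decide (G.Adj u w) = decide (SwCompC G A col (col u) (col w)) ∧
        decide (G.Adj w u) = decide (SwCompC G A col (col w) (col u))) ∧ List.Disjoint l₁ l₂ := by
    refine hpne.imp_of_mem fun {l₁ l₂} h₁ h₂ hne => ⟨fun u hu w hw => ⟨?_, ?_⟩, fun u hu hu' => ?_⟩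
    · exact decide_eq_decide.2 (hadj_iff l₁ h₁ l₂ h₂ hne u hu w hw)
    · exact decide_eq_decide.2 (hadj_iff l₂ h₂ l₁ h₁ hne.symm w hw u hu)
    · exact (hdist l₁ h₁ l₂ h₂ hne u hu u hu').1 rfl
  refine ⟨L.flatten, ?_, ?_, ?_⟩
  · rw [List.nodup_flatten]
    exact ⟨fun l hl => hnd l (hLperm.subset hl), hpw.imp fun h => h.2⟩
  · ext u
    rw [List.mem_toFinset, List.mem_flatten]
    constructor
    · rintro ⟨l, hl, hul⟩
      obtain ⟨a, -, hKa⟩ := hmemK l hl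
      exact swReach_subset A col a (hKa ▸ List.mem_toFinset.2 hul)
    · intro hu
      have hK : swReach G A col u ∈ L.map List.toFinset :=
        hLfin.symm.subset (mem_toList.2 (mem_image_of_mem _ hu))
      obtain ⟨l, hl, hlK⟩ := List.mem_map.1 hK
      exact ⟨l, hl, List.mem_toFinset.1 (hlK ▸ self_mem_swReach col hu)⟩
  · rw [hL]
    exact assembleAND_map_encOf _ col L (hpw.imp fun h => h.1)

/-! ### The process -/

/-- Instances of the components-only Corneil–Goldberg process: non-empty blocks with a colouring. -/
abbrev CGInst (V : Type*) : Type _ := {I : Finset V × (V → ℕ) // I.1.Nonempty}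

variable {G} in
/-- A switching component of a non-empty block is non-empty. -/
theorem nonempty_of_mem_image_swReach {A : Finset V} {col : V → ℕ} {K : Finset V}
    (hK : K ∈ A.image fun u => swReach G A col u) : K.Nonempty := by
  obtain ⟨u, hu, rfl⟩ := mem_image.1 hK
  exact ⟨u, self_mem_swReach col hu⟩

/-- The PARTS of an instance: its switching components, each with the same colouring. -/
noncomputable def cgParts (I : CGInst V) : Finset (CGInst V) :=
  (I.1.1.image fun u => swReach G I.1.1 I.1.2 u).attach.map
    ⟨fun K => ⟨(K.1, I.1.2), nonempty_of_mem_image_swReach K.2⟩, fun K K' h => by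
      have h' := congrArg (fun J : CGInst V => J.1.1) h
      exact Subtype.ext h'⟩

/-- The CHILD of an instance at `x`: individualise `x` and refine inside the block. -/
noncomputable def cgChild (I : CGInst V) (x : V) : CGInst V :=
  ⟨(I.1.1, refineIn G I.1.1 (indiv I.1.2 x)), I.2⟩

/-- The STEP at an instance (the case distinction of `canon`, with the unreachable degenerate case sent to a leaf). -/
noncomputable def cgStep (I : CGInst V) : CertifiedLabels.Step (CGInst V) V :=
  if ∃ u ∈ I.1.1, swReach G I.1.1 I.1.2 u ≠ I.1.1 then .andNode (cgParts G I)
  else if 1 < I.1.1.card ∧ 2 ≤ (smallestCell I.1.1 I.1.2).card then .orNode (smallestCell I.1.1 I.1.2) (cgChild G I)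
  else .leaf

variable {G}

/-- Membership in the parts. -/
theorem mem_cgParts_iff {I J : CGInst V} :
    J ∈ cgParts G I ↔ J.1.2 = I.1.2 ∧ J.1.1 ∈ I.1.1.image fun u => swReach G I.1.1 I.1.2 u := by
  unfold cgParts
  rw [mem_map]
  constructor
  · rintro ⟨K, -, rfl⟩
    exact ⟨rfl, K.2⟩
  · rintro ⟨hcol, hK⟩
    refine ⟨⟨J.1.1, hK⟩, mem_attach _ _, ?_⟩
    apply Subtype.ext
    change (J.1.1, I.1.2) = J.1
    rw [← hcol]

/-- A section step lists exactly the parts, and happens exactly in the disconnected case. -/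
theorem cgStep_eq_andNode_iff {I : CGInst V} {ps : Finset (CGInst V)} :
    cgStep G I = .andNode ps ↔ (∃ u ∈ I.1.1, swReach G I.1.1 I.1.2 u ≠ I.1.1) ∧ ps = cgParts G I := by
  unfold cgStep
  split_ifs with h1 h2
  · simp only [CertifiedLabels.Step.andNode.injEq, h1, true_and]
    exact ⟨fun h => h.symm, fun h => h.symm⟩
  · simp only [false_iff, not_and]
    exact fun h => absurd h h1
  · simp only [false_iff, not_and]
    exact fun h => absurd h h1

/-- An individualisation step has cell `smallestCell` and children `cgChild`, and happens exactly in the connected case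
with `|A| ≥ 2` and a first smallest cell of `≥ 2` vertices. -/
theorem cgStep_eq_orNode_iff {I : CGInst V} {A : Finset V} {ch : V → CGInst V} :
    cgStep G I = .orNode A ch ↔ (¬ ∃ u ∈ I.1.1, swReach G I.1.1 I.1.2 u ≠ I.1.1) ∧
      (1 < I.1.1.card ∧ 2 ≤ (smallestCell I.1.1 I.1.2).card) ∧ A = smallestCell I.1.1 I.1.2 ∧ ch = cgChild G I := by
  unfold cgStep
  split_ifs with h1 h2
  · simp only [false_iff, not_and]
    exact fun h => absurd h1 h
  · simp only [CertifiedLabels.Step.orNode.injEq, h1, not_false_eq_true, h2, and_self, true_and]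
    exact ⟨fun h => ⟨h.1.symm, h.2.symm⟩, fun h => ⟨h.1.symm, h.2.symm⟩⟩
  · simp only [false_iff, not_and]
    exact fun _ h => absurd h h2

/-- Parts are proper sub-blocks. -/
theorem cgParts_ssubset {I J : CGInst V} (hdisc : ∃ u ∈ I.1.1, swReach G I.1.1 I.1.2 u ≠ I.1.1)
    (hJ : J ∈ cgParts G I) : J.1.1 ⊂ I.1.1 := by
  obtain ⟨-, hK⟩ := mem_cgParts_iff.1 hJ
  obtain ⟨w, -, hw⟩ := mem_image.1 hK
  refine ⟨hw ▸ swReach_subset _ _ w, fun hsub => ?_⟩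
  have := card_swReach_lt_of_disconnected hdisc hK
  have := card_le_card hsub
  omega

variable (G)

/-- **The components-only Corneil–Goldberg process as a `CertifiedLabels.Process`.** -/
noncomputable def cgProcess : CertifiedLabels.Process V where
  Inst := CGInst V
  verts I := I.1.1
  step := cgStep G
  parts_ssubset I ps hs J hJ := by
    obtain ⟨hdisc, rfl⟩ := cgStep_eq_andNode_iff.1 hs
    exact cgParts_ssubset hdisc hJ

variable {G}

/-- Children keep the vertex set. -/
theorem verts_cgChild (I : CGInst V) (x : V) : (cgProcess G).verts (cgChild G I x) = (cgProcess G).verts I := rfl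

/-- Distinct parts of a section node are vertex-disjoint. -/
theorem cgStep_parts_disjoint (I : CGInst V) (ps : Finset (CGInst V)) (hs : (cgProcess G).step I = .andNode ps)
    (J₁ : CGInst V) (h₁ : J₁ ∈ ps) (J₂ : CGInst V) (h₂ : J₂ ∈ ps) (hne : J₁ ≠ J₂) :
    Disjoint ((cgProcess G).verts J₁) ((cgProcess G).verts J₂) := by
  obtain ⟨-, rfl⟩ := cgStep_eq_andNode_iff.1 hs
  obtain ⟨hc₁, hK₁⟩ := mem_cgParts_iff.1 h₁
  obtain ⟨hc₂, hK₂⟩ := mem_cgParts_iff.1 h₂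
  obtain ⟨a, ha, hKa⟩ := mem_image.1 hK₁
  obtain ⟨b, hb, hKb⟩ := mem_image.1 hK₂
  rw [Finset.disjoint_left]
  intro u hu₁ hu₂
  apply hne
  have hu₁' : u ∈ swReach G I.1.1 I.1.2 a := hKa ▸ hu₁
  have hu₂' : u ∈ swReach G I.1.1 I.1.2 b := hKb ▸ hu₂
  have hKK : J₁.1.1 = J₂.1.1 := by
    rw [← hKa, ← hKb, ← swReach_eq_of_mem _ ha hu₁', ← swReach_eq_of_mem _ hb hu₂']
  exact Subtype.ext (Prod.ext hKK (hc₁.trans hc₂.symm))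

/-- Every instance is non-empty. -/
theorem verts_nonempty (I : CGInst V) : ((cgProcess G).verts I).Nonempty := I.2

/-! ### The valuation: realised copies -/

/-- Lists over a finset read through `attach`, as multisets. -/
private theorem coe_toList_attach_map' {α β : Type*} (s : Finset α) (g : α → β) :
    ((s.attach.toList.map fun x => g x.1) : Multiset β) = s.val.map g := by
  rw [← Multiset.map_coe, coe_toList]
  have h : (s.val.attach.map Subtype.val).map g = s.val.map g := congrArg (Multiset.map g) (Multiset.attach_map_val s.val)
  rw [Multiset.map_map] at h
  exact h

variable (G)

/-- A GOOD value of `(A, col)`: its copy read along an enumeration of `A`. -/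
def CGGood (I : CGInst V) (E : Enc) : Prop := ∃ l : List V, l.Nodup ∧ l.toFinset = I.1.1 ∧ E = encOf G I.1.2 l

/-- The value of a leaf: read along `A.toList`. -/
noncomputable def cgLeafVal (I : CGInst V) : Enc := encOf G I.1.2 I.1.1.toList

/-- PASTING: `assembleAND` of the sorted part values with the colour-level switching data. -/
noncomputable def cgPaste (I : CGInst V) (f : CGInst V → Enc) : Enc :=
  assembleAND (fun k k' => decide (SwCompC G I.1.1 I.1.2 k k')) (((cgParts G I).toList.map f).insertionSort (· ≤ ·))

/-- LIFTING the value of the child at `x`: read the colours back. -/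
noncomputable def cgLift (I : CGInst V) (x : V) (E : Enc) : Enc :=
  recolour (colMap I.1.1 (refineIn G I.1.1 (indiv I.1.2 x)) I.1.2) E

/-- CHOICE: the lexicographic minimum. -/
noncomputable def cgPick (S : Finset Enc) : Option Enc := if h : S.Nonempty then some (S.min' h) else none

variable {G}

/-- Leaves are read off correctly (in fact every instance is, along `toList`). -/
theorem cgGood_leaf (I : CGInst V) : CGGood G I (cgLeafVal G I) := ⟨I.1.1.toList, nodup_toList _, toList_toFinset _, rfl⟩

/-- **(P1)** good values of all parts paste to a good value. -/
theorem cgGood_paste (I : CGInst V) (ps : Finset (CGInst V)) (f : CGInst V → Enc) (hs : cgStep G I = .andNode ps)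
    (hf : ∀ J ∈ ps, CGGood G J (f J)) : CGGood G I (cgPaste G I f) := by
  obtain ⟨-, rfl⟩ := cgStep_eq_andNode_iff.1 hs
  -- choose the realising enumerations of the parts
  have hch : ∀ J : {J // J ∈ cgParts G I}, ∃ l : List V, l.Nodup ∧ l.toFinset = J.1.1.1 ∧ f J.1 = encOf G I.1.2 l := by
    rintro ⟨J, hJ⟩
    obtain ⟨l, hl, hlJ, hE⟩ := hf J hJ
    exact ⟨l, hl, hlJ, (mem_cgParts_iff.1 hJ).1 ▸ hE⟩
  choose lf hlf using hch
  refine exists_assembleAND_sort_eq_encOf ((cgParts G I).attach.toList.map lf) (fun l hl => ?_) ?_ _ ?_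
  · obtain ⟨J, -, rfl⟩ := List.mem_map.1 hl
    exact (hlf J).1
  · -- the parts' vertex sets are the components, each once
    rw [← Multiset.coe_eq_coe, List.map_map, coe_toList]
    have h1 := coe_toList_attach_map' (cgParts G I) fun J => J.1.1
    have h2 : ((cgParts G I).attach.toList.map (List.toFinset ∘ lf) : Multiset (Finset V)) =
        ((cgParts G I).attach.toList.map fun J => J.1.1.1 : Multiset (Finset V)) :=
      Multiset.coe_eq_coe.2 (List.Perm.of_eq (List.map_congr_left fun J _ => (hlf J).2.1))
    rw [h2, h1]
    unfold cgParts
    rw [map_val, Multiset.map_map]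
    exact Multiset.attach_map_val _
  · -- the given values are the copies, up to the order of `toList`
    rw [← Multiset.coe_eq_coe, List.map_map, ← Multiset.map_coe, coe_toList]
    have h2 : ((cgParts G I).attach.toList.map (encOf G I.1.2 ∘ lf) : Multiset Enc) =
        ((cgParts G I).attach.toList.map fun J => f J.1 : Multiset Enc) :=
      Multiset.coe_eq_coe.2 (List.Perm.of_eq (List.map_congr_left fun J _ => (hlf J).2.2.symm))
    rw [h2, coe_toList_attach_map']

/-- **(P2)** a good value of the child at `x` lifts to a good value. -/
theorem cgGood_lift (I : CGInst V) (A : Finset V) (ch : V → CGInst V) (x : V) (E : Enc) (hs : cgStep G I = .orNode A ch)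
    (_hx : x ∈ A) (hE : CGGood G (ch x) E) : CGGood G I (cgLift G I x E) := by
  obtain ⟨-, -, rfl, rfl⟩ := cgStep_eq_orNode_iff.1 hs
  obtain ⟨l, hl, hlA, rfl⟩ := hE
  refine ⟨l, hl, hlA, ?_⟩
  show recolour _ (encOf G (refineIn G I.1.1 (indiv I.1.2 x)) l) = _
  rw [recolour_encOf]
  refine encOf_congr fun u hu => ?_
  have huA : u ∈ I.1.1 := by
    have : u ∈ l.toFinset := List.mem_toFinset.2 hu
    rwa [hlA] at this
  exact colMap_refineIn_indiv (G := G) I.1.2 x huA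

/-- The chosen value is one of the offered ones. -/
theorem cgPick_mem (S : Finset Enc) (E : Enc) (h : cgPick S = some E) : E ∈ S := by
  unfold cgPick at h
  by_cases hS : S.Nonempty
  · rw [dif_pos hS, Option.some.injEq] at h
    exact h ▸ min'_mem S hS
  · rw [dif_neg hS] at h
    exact absurd h (by simp)

/-- Something is chosen from a non-empty offer. -/
theorem cgPick_ne_none (S : Finset Enc) (hS : S.Nonempty) : cgPick S ≠ none := by
  unfold cgPick; rw [dif_pos hS]; exact Option.some_ne_none _

variable (G)

/-- **The realised valuation of the concrete process**: values are encodings; a good value of `(A, col)` is its copy read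
along an enumeration of `A`; pasting = `assembleAND` of the sorted part values, lifting = colour read-back, choice = lex-min. -/
noncomputable def cgValuation : CertifiedLabels.Valuation (cgProcess G) Enc where
  Good := CGGood G
  leafVal := cgLeafVal G
  paste := cgPaste G
  lift := cgLift G
  pick := cgPick
  good_leaf I _ := cgGood_leaf I
  good_paste I ps f hs hf := cgGood_paste I ps f hs hf
  good_lift I A ch x E hs hx hE := cgGood_lift I A ch x E hs hx hE
  pick_mem := cgPick_mem
  pick_ne_none := cgPick_ne_none

variable {G}

/-- **Soundness of the certified-label scheme for the concrete process** (`CertifiedLabels.val_sound` instantiated): for ANY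
decoding map, admissibility predicate and value range, whatever a label group outputs is the copy of the block it decodes to,
read along an enumeration of that block. -/
theorem cg_val_sound [Fintype V] (dec : CertifiedLabels.Label V → Option (CGInst V)) (adm : CertifiedLabels.Label V → Prop)
    (g : ℕ) (L : CertifiedLabels.Label V) (E : Enc)
    (h : CertifiedLabels.val (cgProcess G) (cgValuation G) dec adm g L = some E) :
    ∃ I : CGInst V, dec L = some I ∧ ∃ l : List V, l.Nodup ∧ l.toFinset = I.1.1 ∧ E = encOf G I.1.2 l :=
  CertifiedLabels.val_sound (cgProcess G) (cgValuation G) dec adm g L E h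

end BranchSum

end Summit.PneNP.PneNP.Theorems
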